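import Literature.NumberTheory.Automorphic.SymplecticSimilitudeHyperspecialCompactOpen
import HarnessLib

/-!
# `GSp(J, 𝒪)` is a MAXIMAL compact subgroup of `GSp(J, K)`

Topic `NumberTheory/Automorphic`; namespace `Literature.NumberTheory.Automorphic.SymplecticCartan` (lane `lit-hodgefound`,
Track 2 foundations; seat `lit-hodgefound-p11`, generation 34, row g34-#4, file 12).  THEOREMS ONLY (D-0026): no definition,
no named fact, no instance, no notation.  Sequel of `SymplecticSimilitudeHyperspecialCompactOpen`.

## The print

[Tits1979] §3.2: «special (in particular hyperspecial) points give maximal compact subgroups `K = G(𝒪)`»; for `G = GSp` at a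
place of good reduction this is the `K_p` of [Kottwitz1992] §7 (Case C).  Proof here: a compact subgroup `H ⊇ GSp(J, 𝒪)`
contains, with every `h = k₁ T k₂` (`exists_cartan_decomposition_of_similitude`, `kᵢ ∈ Sp(J, 𝒪)`, `T = diag(μ ϖ^{a}; ϖ^{-a})`),
all powers `T^{±n}`; the entries of a compact set of matrices are bounded, so `a = 0` and `v(μ) = 1`, i.e. `T ∈ GSp(J, 𝒪)`.

## What is formalised (`K` a field with `Valued K ℤᵐ⁰` and a uniformiser `ϖ`; `l` a finite index type)

* §1 `isOpen_setOf_v_le_exp`, `exists_forall_v_le_exp_of_isCompact` (a compact subset of `K` is bounded),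
  `v_eq_one_of_forall_pow_le` (`v(xⁿ), v(x⁻ⁿ)` bounded ⇒ `v(x) = 1`).
* §2 `coe_conj_eq_diagonal` (the middle Cartan factor `k₁⁻¹ h k₂⁻¹` as an element of `GSp(J, K)` has matrix
  `diag(μ ϖ^{a}; ϖ^{-a})`), `diagonal_mem_symplecticSimilitudeInt` (a diagonal similitude with unit entries is in `GSp(J, 𝒪)`).
* §3 **`eq_symplecticSimilitudeInt_of_isCompact_of_le`** — a compact subgroup of `GSp(J, K)` containing `GSp(J, 𝒪)` equals it;
  `eq_symplecticSimilitudeInt_of_isCompact_of_le_adicCompletion` (every finite place of a number field).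

## References
* [Tits1979] J. Tits, *Reductive groups over local fields*, Proc. Symp. Pure Math. 33.1 (1979), §3.2, §3.3.3.
* [Kottwitz1992] R. E. Kottwitz, J. AMS 5 (1992), §7.
* [AndrianovZhuravlev1995] A. N. Andrianov, V. G. Zhuravlev (1995), Ch. 3 §3, Lemma 3.6.
-/

noncomputable section

open scoped Valued WithZero MatrixGroups
open Matrix

namespace Literature.NumberTheory.Automorphic.SymplecticCartan

variable {K : Type*} [Field K] [Valued K ℤᵐ⁰] {ϖ : K} {l : Type*} [Fintype l] [DecidableEq l]

/-! ## §1 Compact sets of a discretely valued field are bounded -/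

omit [Fintype l] [DecidableEq l] in
/-- `{x : v(x) ≤ exp m}` is open (`= ϖ^{-m} 𝒪`). [cite: Tits1979, §3.2] -/
theorem isOpen_setOf_v_le_exp (hϖ : Valued.v ϖ = WithZero.exp (-1 : ℤ)) (m : ℕ) :
    IsOpen {x : K | Valued.v x ≤ WithZero.exp (m : ℤ)} := by
  have h : {x : K | Valued.v x ≤ WithZero.exp (m : ℤ)} = (fun x => ϖ ^ m * x) ⁻¹' {x : K | Valued.v x ≤ 1} := by
    ext x
    simp only [Set.mem_setOf_eq, Set.mem_preimage]
    rw [map_mul, map_pow, hϖ, ← WithZero.exp_nsmul, nsmul_eq_mul, mul_neg, mul_one]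
    constructor
    · intro h
      calc WithZero.exp (-(m : ℤ)) * Valued.v x ≤ WithZero.exp (-(m : ℤ)) * WithZero.exp (m : ℤ) :=
            mul_le_mul_right h _
        _ = 1 := by rw [← WithZero.exp_add, neg_add_cancel, WithZero.exp_zero]
    · intro h
      calc Valued.v x = WithZero.exp (m : ℤ) * (WithZero.exp (-(m : ℤ)) * Valued.v x) := by
            rw [← mul_assoc, ← WithZero.exp_add, add_neg_cancel, WithZero.exp_zero, one_mul]
        _ ≤ WithZero.exp (m : ℤ) * 1 := mul_le_mul_right h _
        _ = WithZero.exp (m : ℤ) := mul_one _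
  rw [h]
  exact (Valued.isOpen_integer K).preimage (continuous_const.mul continuous_id)

omit [Fintype l] [DecidableEq l] in
/-- **A compact subset of `K` is bounded**: `v ≤ exp m` on it for some `m : ℕ`. [cite: Tits1979, §3.2] -/
theorem exists_forall_v_le_exp_of_isCompact (hϖ : Valued.v ϖ = WithZero.exp (-1 : ℤ)) {s : Set K} (hs : IsCompact s) :
    ∃ m : ℕ, ∀ x ∈ s, Valued.v x ≤ WithZero.exp (m : ℤ) := by
  have hmono : Monotone fun m : ℕ => {x : K | Valued.v x ≤ WithZero.exp (m : ℤ)} :=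
    fun m m' hmm' x hx => le_trans hx (WithZero.exp_le_exp.2 (by exact_mod_cast hmm'))
  have hcover : s ⊆ ⋃ m : ℕ, {x : K | Valued.v x ≤ WithZero.exp (m : ℤ)} := by
    intro x _
    by_cases h0 : x = 0
    · exact Set.mem_iUnion.2 ⟨0, by rw [Set.mem_setOf_eq, h0, map_zero]; exact zero_le⟩
    · have hne : Valued.v x ≠ 0 := (Valuation.ne_zero_iff _).2 h0
      refine Set.mem_iUnion.2 ⟨(WithZero.log (Valued.v x)).toNat, ?_⟩
      rw [Set.mem_setOf_eq]
      conv_lhs => rw [← WithZero.exp_log hne]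
      exact WithZero.exp_le_exp.2 (Int.self_le_toNat _)
  obtain ⟨m, hm⟩ := hs.elim_directed_cover _ (fun m => isOpen_setOf_v_le_exp hϖ m) hcover (Monotone.directed_le hmono)
  exact ⟨m, fun x hx => hm hx⟩

omit [Fintype l] [DecidableEq l] in
/-- If `v(xⁿ) ≤ exp m` and `v(x⁻ⁿ) ≤ exp m` for all `n`, then `v(x) = 1`. [cite: Tits1979, §3.2] -/
theorem v_eq_one_of_forall_pow_le {x : K} (hx : x ≠ 0) {m : ℕ}
    (h1 : ∀ n : ℕ, Valued.v (x ^ n) ≤ WithZero.exp (m : ℤ))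
    (h2 : ∀ n : ℕ, Valued.v (x⁻¹ ^ n) ≤ WithZero.exp (m : ℤ)) : Valued.v x = 1 := by
  have hne : Valued.v x ≠ 0 := (Valuation.ne_zero_iff _).2 hx
  set z : ℤ := WithZero.log (Valued.v x) with hz
  have hvx : Valued.v x = WithZero.exp z := (WithZero.exp_log hne).symm
  have h1' : ∀ n : ℕ, (n : ℤ) * z ≤ m := fun n => by
    have := h1 n
    rwa [map_pow, hvx, ← WithZero.exp_nsmul, WithZero.exp_le_exp, nsmul_eq_mul] at this
  have h2' : ∀ n : ℕ, (n : ℤ) * (-z) ≤ m := fun n => by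
    have := h2 n
    rwa [map_pow, map_inv₀, hvx, ← WithZero.exp_neg, ← WithZero.exp_nsmul, WithZero.exp_le_exp, nsmul_eq_mul] at this
  have hz0 : z = 0 := by
    have ha := h1' (m + 1)
    have hb := h2' (m + 1)
    push_cast at ha hb
    rcases lt_trichotomy z 0 with hlt | heq | hgt
    · have : ((m : ℤ) + 1) * 1 ≤ ((m : ℤ) + 1) * (-z) :=
        mul_le_mul_of_nonneg_left (by omega) (by positivity)
      omega
    · exact heq
    · have : ((m : ℤ) + 1) * 1 ≤ ((m : ℤ) + 1) * z :=
        mul_le_mul_of_nonneg_left (by omega) (by positivity)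
      omega
  rw [hvx, hz0, WithZero.exp_zero]

/-! ## §2 The middle Cartan factor inside `GSp(J, K)` -/

omit [Valued K ℤᵐ⁰] in
/-- If `h = k₁ T k₂` as matrices then the element `k₁⁻¹ h k₂⁻¹` of `GSp(J, K)` has matrix `T`.
[cite: AndrianovZhuravlev1995, Ch. 3 §3, Lemma 3.6] -/
theorem coe_conj_eq_of_eq_mul_mul {h K₁ K₂ : symplecticSimilitudeGroup l K} {T : Matrix (l ⊕ l) (l ⊕ l) K}
    (hdec : ((h : GL (l ⊕ l) K) : Matrix (l ⊕ l) (l ⊕ l) K) =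
      ((K₁ : GL (l ⊕ l) K) : Matrix (l ⊕ l) (l ⊕ l) K) * T * ((K₂ : GL (l ⊕ l) K) : Matrix (l ⊕ l) (l ⊕ l) K)) :
    (((K₁⁻¹ * h * K₂⁻¹ : symplecticSimilitudeGroup l K) : GL (l ⊕ l) K) : Matrix (l ⊕ l) (l ⊕ l) K) = T := by
  have h1 : (((K₁⁻¹ : symplecticSimilitudeGroup l K) : GL (l ⊕ l) K) : Matrix (l ⊕ l) (l ⊕ l) K) *
      ((K₁ : GL (l ⊕ l) K) : Matrix (l ⊕ l) (l ⊕ l) K) = 1 := by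
    rw [Subgroup.coe_inv, ← Units.val_mul, inv_mul_cancel, Units.val_one]
  have h2 : ((K₂ : GL (l ⊕ l) K) : Matrix (l ⊕ l) (l ⊕ l) K) *
      (((K₂⁻¹ : symplecticSimilitudeGroup l K) : GL (l ⊕ l) K) : Matrix (l ⊕ l) (l ⊕ l) K) = 1 := by
    rw [Subgroup.coe_inv, ← Units.val_mul, mul_inv_cancel, Units.val_one]
  rw [Subgroup.coe_mul, Subgroup.coe_mul, Units.val_mul, Units.val_mul, hdec]
  calc (((K₁⁻¹ : symplecticSimilitudeGroup l K) : GL (l ⊕ l) K) : Matrix (l ⊕ l) (l ⊕ l) K) *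
        (((K₁ : GL (l ⊕ l) K) : Matrix (l ⊕ l) (l ⊕ l) K) * T * ((K₂ : GL (l ⊕ l) K) : Matrix (l ⊕ l) (l ⊕ l) K)) *
        (((K₂⁻¹ : symplecticSimilitudeGroup l K) : GL (l ⊕ l) K) : Matrix (l ⊕ l) (l ⊕ l) K)
      = ((((K₁⁻¹ : symplecticSimilitudeGroup l K) : GL (l ⊕ l) K) : Matrix (l ⊕ l) (l ⊕ l) K) *
          ((K₁ : GL (l ⊕ l) K) : Matrix (l ⊕ l) (l ⊕ l) K)) * T *
          (((K₂ : GL (l ⊕ l) K) : Matrix (l ⊕ l) (l ⊕ l) K) *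
            (((K₂⁻¹ : symplecticSimilitudeGroup l K) : GL (l ⊕ l) K) : Matrix (l ⊕ l) (l ⊕ l) K)) := by
        simp only [Matrix.mul_assoc]
    _ = T := by rw [h1, h2, Matrix.one_mul, Matrix.mul_one]

omit [Valued K ℤᵐ⁰] in
/-- The inverse of an element of `GSp(J, K)` with diagonal matrix `diag(d)` has matrix `diag(d⁻¹)`.
[cite: AndrianovZhuravlev1995, Ch. 3 §3] -/
theorem coe_inv_eq_diagonal_of_coe_eq_diagonal {X : symplecticSimilitudeGroup l K} {d : l ⊕ l → K} (hd0 : ∀ k, d k ≠ 0)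
    (hX : ((X : GL (l ⊕ l) K) : Matrix (l ⊕ l) (l ⊕ l) K) = Matrix.diagonal d) :
    (((X⁻¹ : symplecticSimilitudeGroup l K) : GL (l ⊕ l) K) : Matrix (l ⊕ l) (l ⊕ l) K) =
      Matrix.diagonal fun k => (d k)⁻¹ := by
  have hTiT : (Matrix.diagonal fun k => (d k)⁻¹) * Matrix.diagonal d = 1 := by
    rw [Matrix.diagonal_mul_diagonal, ← Matrix.diagonal_one]
    exact congrArg _ (funext fun k => inv_mul_cancel₀ (hd0 k))
  rw [Subgroup.coe_inv, Matrix.coe_units_inv, hX]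
  exact Matrix.inv_eq_left_inv hTiT

omit [Valued K ℤᵐ⁰] in
/-- Powers inside `GSp(J, K)` of an element with diagonal matrix. [cite: AndrianovZhuravlev1995, Ch. 3 §3] -/
theorem coe_pow_eq_diagonal_pow {X : symplecticSimilitudeGroup l K} {d : l ⊕ l → K}
    (hX : ((X : GL (l ⊕ l) K) : Matrix (l ⊕ l) (l ⊕ l) K) = Matrix.diagonal d) (n : ℕ) :
    (((X ^ n : symplecticSimilitudeGroup l K) : GL (l ⊕ l) K) : Matrix (l ⊕ l) (l ⊕ l) K) =
      Matrix.diagonal fun k => d k ^ n := by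
  rw [Subgroup.coe_pow, Units.val_pow_eq_pow_val, hX, Matrix.diagonal_pow]
  rfl

/-- **A diagonal similitude with unit entries lies in `GSp(J, 𝒪)`.** [cite: Tits1979, §3.3.3] -/
theorem mem_symplecticSimilitudeInt_of_coe_eq_diagonal {X : symplecticSimilitudeGroup l K} {d : l ⊕ l → K}
    (hX : ((X : GL (l ⊕ l) K) : Matrix (l ⊕ l) (l ⊕ l) K) = Matrix.diagonal d) (hd : ∀ k, Valued.v (d k) = 1) :
    X ∈ symplecticSimilitudeInt l K := by
  have hd0 : ∀ k, d k ≠ 0 := fun k h0 => by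
    have := hd k
    rw [h0, map_zero] at this
    exact zero_ne_one this
  refine mem_symplecticSimilitudeInt_iff.2 ⟨fun i j => ?_, fun i j => ?_⟩
  · rw [hX, Matrix.diagonal_apply]
    split_ifs
    · exact (hd i).le
    · rw [map_zero]; exact zero_le
  · rw [← Subgroup.coe_inv, coe_inv_eq_diagonal_of_coe_eq_diagonal hd0 hX, Matrix.diagonal_apply]
    split_ifs
    · rw [map_inv₀, hd i, inv_one]
    · rw [map_zero]; exact zero_le

/-! ## §3 Maximality -/

/-- **`GSp(J, 𝒪)` is a maximal compact subgroup of `GSp(J, K)`**: a compact subgroup `H` with `GSp(J, 𝒪) ≤ H` equals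
`GSp(J, 𝒪)`.  For `h ∈ H` write `h = k₁ T k₂` (`exists_cartan_decomposition_of_similitude`); `T = k₁⁻¹ h k₂⁻¹ ∈ H` and all
`T^{±n} ∈ H` have bounded entries (`H` compact), forcing `a = 0` and `v(μ) = 1`, so `T ∈ GSp(J, 𝒪)` and `h ∈ GSp(J, 𝒪)`.
[cite: Tits1979, §3.2; Kottwitz1992, §7] -/
theorem eq_symplecticSimilitudeInt_of_isCompact_of_le (hϖ : Valued.v ϖ = WithZero.exp (-1 : ℤ))
    (H : Subgroup (symplecticSimilitudeGroup l K)) (hH : IsCompact (H : Set (symplecticSimilitudeGroup l K)))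
    (hle : symplecticSimilitudeInt l K ≤ H) : H = symplecticSimilitudeInt l K := by
  refine le_antisymm (fun h hh => ?_) hle
  have hϖ0 : ϖ ≠ 0 := fun h0 => by
    rw [h0, map_zero] at hϖ
    exact WithZero.coe_ne_zero hϖ.symm
  obtain ⟨μ, hμ, hg⟩ := h.2
  obtain ⟨k₁, k₂, a, hk₁, hk₂, hdec⟩ := exists_cartan_decomposition_of_similitude hϖ hμ hg
  set K₁ : symplecticSimilitudeGroup l K := ofSymplectic k₁ with hK₁
  set K₂ : symplecticSimilitudeGroup l K := ofSymplectic k₂ with hK₂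
  have hK₁H : K₁ ∈ H := hle (ofSymplectic_mem_symplecticSimilitudeInt hk₁)
  have hK₂H : K₂ ∈ H := hle (ofSymplectic_mem_symplecticSimilitudeInt hk₂)
  set d : l ⊕ l → K := Sum.elim (fun i => μ * ϖ ^ a i) (fun i => ϖ ^ (-a i)) with hd
  set X : symplecticSimilitudeGroup l K := K₁⁻¹ * h * K₂⁻¹ with hXdef
  have hX : ((X : GL (l ⊕ l) K) : Matrix (l ⊕ l) (l ⊕ l) K) = Matrix.diagonal d := coe_conj_eq_of_eq_mul_mul hdec
  have hXH : X ∈ H := H.mul_mem (H.mul_mem (H.inv_mem hK₁H) hh) (H.inv_mem hK₂H)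
  have hd0 : ∀ k, d k ≠ 0 := by
    rintro (i | i)
    · rw [hd, Sum.elim_inl]; exact mul_ne_zero hμ (zpow_ne_zero _ hϖ0)
    · rw [hd, Sum.elim_inr]; exact zpow_ne_zero _ hϖ0
  have hXi := coe_inv_eq_diagonal_of_coe_eq_diagonal hd0 hX
  -- the diagonal entries of all `X^{±n} ∈ H` are bounded, hence units
  have hunit : ∀ k, Valued.v (d k) = 1 := fun k => by
    have hcont : Continuous fun g : symplecticSimilitudeGroup l K => ((g : GL (l ⊕ l) K) : Matrix (l ⊕ l) (l ⊕ l) K) k k :=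
      (Units.continuous_val.comp continuous_subtype_val).matrix_elem k k
    obtain ⟨m, hm⟩ := exists_forall_v_le_exp_of_isCompact hϖ (hH.image hcont)
    refine v_eq_one_of_forall_pow_le (hd0 k) (m := m) (fun n => ?_) (fun n => ?_)
    · have := hm _ ⟨X ^ n, H.pow_mem hXH n, rfl⟩
      dsimp only at this
      rwa [coe_pow_eq_diagonal_pow hX, Matrix.diagonal_apply_eq] at this
    · have := hm _ ⟨X⁻¹ ^ n, H.pow_mem (H.inv_mem hXH) n, rfl⟩
      dsimp only at this
      rwa [coe_pow_eq_diagonal_pow hXi, Matrix.diagonal_apply_eq] at this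
  have hXint : X ∈ symplecticSimilitudeInt l K := mem_symplecticSimilitudeInt_of_coe_eq_diagonal hX hunit
  have heq : h = K₁ * X * K₂ := by rw [hXdef]; group
  rw [heq]
  exact (symplecticSimilitudeInt l K).mul_mem ((symplecticSimilitudeInt l K).mul_mem
    (ofSymplectic_mem_symplecticSimilitudeInt hk₁) hXint) (ofSymplectic_mem_symplecticSimilitudeInt hk₂)

/-- The exponents and the multiplier of a COMPACT subgroup are trivial: under the hypotheses of
`eq_symplecticSimilitudeInt_of_isCompact_of_le`, every `h ∈ H` has all entries of `h` and `h⁻¹` integral. [cite: Tits1979, §3.2] -/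
theorem forall_v_apply_le_one_of_isCompact_of_le (hϖ : Valued.v ϖ = WithZero.exp (-1 : ℤ))
    (H : Subgroup (symplecticSimilitudeGroup l K)) (hH : IsCompact (H : Set (symplecticSimilitudeGroup l K)))
    (hle : symplecticSimilitudeInt l K ≤ H) {h : symplecticSimilitudeGroup l K} (hh : h ∈ H) :
    (∀ i j, Valued.v (((h : GL (l ⊕ l) K) : Matrix (l ⊕ l) (l ⊕ l) K) i j) ≤ 1) ∧
      ∀ i j, Valued.v ((((h : GL (l ⊕ l) K)⁻¹ : GL (l ⊕ l) K) : Matrix (l ⊕ l) (l ⊕ l) K) i j) ≤ 1 := by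
  have hmem : h ∈ symplecticSimilitudeInt l K := by
    rw [← eq_symplecticSimilitudeInt_of_isCompact_of_le hϖ H hH hle]; exact hh
  exact mem_symplecticSimilitudeInt_iff.1 hmem

/-! ### At the finite places of a number field -/

section NumberField

open IsDedekindDomain NumberField

variable (F : Type*) [Field F] [NumberField F] (v : HeightOneSpectrum (𝓞 F))

/-- **`GSp(J, 𝒪_v)` is a maximal compact subgroup of `GSp(J, F_v)`** at every finite place `v` of a number field.
[cite: Tits1979, §3.2, §3.3.3; Kottwitz1992, §7] -/
theorem eq_symplecticSimilitudeInt_of_isCompact_of_le_adicCompletion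
    (H : Subgroup (symplecticSimilitudeGroup l (v.adicCompletion F)))
    (hH : IsCompact (H : Set (symplecticSimilitudeGroup l (v.adicCompletion F))))
    (hle : symplecticSimilitudeInt l (v.adicCompletion F) ≤ H) : H = symplecticSimilitudeInt l (v.adicCompletion F) := by
  obtain ⟨π, hπ⟩ := HeightOneSpectrum.valuation_exists_uniformizer F v
  have hϖ : Valued.v (π : v.adicCompletion F) = WithZero.exp (-1 : ℤ) := by
    rw [HeightOneSpectrum.valuedAdicCompletion_eq_valuation', hπ]
  exact eq_symplecticSimilitudeInt_of_isCompact_of_le hϖ H hH hle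

end NumberField

end Literature.NumberTheory.Automorphic.SymplecticCartan

end
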